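import Summits.BirchSwinnertonDyer.BirchSwinnertonDyer.Theorems.QuadraticBranchSignedControlPlusEtaLowerInclusionTamagawaRoadMordellWeilCount
import Summits.BirchSwinnertonDyer.BirchSwinnertonDyer.Theorems.QuadraticBranchSignedControlPlusEtaLowerInclusionTamagawaRoadLevel
import Summits.BirchSwinnertonDyer.BirchSwinnertonDyer.Theorems.QuadraticBranchSignedControlPlusEtaR1TamagawaRowShape
import HarnessLib

/-!
# Route `QuadraticBranchSignedControl` (rung K8, cell `bsd-potss`), crux `PlusEtaLowerInclusion`
# (item stmt-BirchSwinnertonDyer-19601): THE TAMAGAWA ROAD WITH THE MORDELL–WEIL CLASSES, part 3 —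
# `p^v ∣ #(X_η/TX_η)_tors` for EVERY `v ≤ ∑_T ord_p c_ℓ(W)` (NO `−k·r` loss) and (E⁺_η) / (E⁺_η) ∧
# (C1⁺_η) at a tower-onto pair of ANY rank, under the `T`-local divisibility of `W(ℚ)`

WHAT. g4's road (`…TamagawaRoadLevel` p515783) reads `v + k·r ≤ ∑_T ord_p c_ℓ(W)`; with the
Mordell–Weil classes in the count (parts 1–2: `∏_T p^{ord_p c_ℓ} · #κ_{p^m}(W(ℚ)) ∣ #S^Γ[p^m]`,
`#κ_{p^m}(W(ℚ)) ≥ p^{m·rank W(ℚ)}`, `rank W(ℚ) = r`) the divisible part is paid for and the arithmetic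
input becomes **`v ≤ ∑_T ord_p c_ℓ(W)`**:
* §5 `pow_dvd_natCard_torsion_coinvariants_of_namedFacts_of_poitouTate_of_tamagawa_of_mordellWeilDivisible`;
* §6 **`quadraticBranchPlusEtaLowerInclusionAt_of_namedFacts_of_certV_of_poitouTate_of_tamagawa_of_mordellWeilDivisible`**
  — (E⁺_η)(V, p) from the named facts (Kobayashi 1.2/1.3/2.2η/4.1η, Kitajima–Otsuki 1.3η, Poitou–Tate),
  `p ≥ 5`, tower onto, the `V`-certificate, the analytic certificate `p^{v+1} ∤ coeff_r L_p⁺(V,η,T)`,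
  the Tamagawa data of `W` on `T` and the displayed `T`-local divisibility `hdivT` — NO rank hypothesis;
* §7 the pair's (E⁺_η) ∧ (C1⁺_η).
READING (Perrin-Riou / B. D. Kim shape of the leading term, not used): a rational point meeting a
component of `p`-power order at `ℓ` puts the denominator `c_ℓ^{(p)2}` into its `p`-adic height — the
`−k·r` of g4's road; `hdivT` is the denominator-free case, where the Tamagawa numbers count in full.
On 19601's census (kit j275435): the rank-one tower-onto row `499800hw1`@7 (`T = {3}`, `c₃ = 7`,
`v_an = 1`, generator on the identity component at `3`) satisfies `hdivT` with `v = 1 = ∑`; the 13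
Tamagawa-`5` rows of g4 do not (component order `5` at both primes, `v_an = 1 = ∑ − 1`).

HONEST FRAMING (cell `bsd-potss`, run/shared/lean/pub/bsd-potss/; FULL-BSD rank ≤ 1 programme, HUMAN
RULING D-0036/D-0074): TOOL THEOREMS ONLY — no definition, no named Literature fact minted, no `sorry`,
axioms standard; the crux 19601 (class-wide Eisenstein inclusion at `η`) is OPEN and NOT closed; no row
is certified by this file; nothing is booked; `BSD(W, p)` is claimed for no pair.
`--supports stmt-BirchSwinnertonDyer-19601` (seat `bsd-potss-k8eta-c1`, gen 5). CONDITIONAL on the named facts in hypothesis position, tower onto, the `V`-certificate, the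
analytic certificate and the DISPLAYED `hdivT` (supplied here for NO pair), stated in its cohomological
form `loc_w κ_{p^m}(P) = 0` — the `ℚ`-statements speak of `κ P` (which carries the Kummer map's own group
law on `W(ℚ)`, elaborated in `KummerMap.lean` with the classical `DecidableEq`); part 1's
`localization_kummerMapTorsion_eq_zero_of_divisible` turns the per-row divisibility `P ∈ p^m W(ℚ_w)` into it.

References: [Kobayashi2003] Thm. 2.2 (p. 5), §4 + Thm. 4.1 (p. 8), Thm. 9.3 (pp. 26–27);
[KitajimaOtsuki2018] Thm. 1.3; [MilneADT2006] I Thm. 4.10; [CoatesSchneiderSujatha2003] §3 (30)–(31);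
[PerrinRiou1993] (shape of the leading term, not used).
-/


set_option autoImplicit false
set_option linter.dupNamespace false

noncomputable section

open scoped Classical AddSubgroup

open CategoryTheory Field Function NumberField IsDedekindDomain WeierstrassCurve CongruenceSubgroup
open Literature.NumberTheory.EllipticCurves
open Literature.NumberTheory.EllipticCurves.ModularForms
open Literature.NumberTheory.GaloisRepresentations
open Literature.NumberTheory.GaloisRepresentations.DiscreteGaloisModule (SelmerStructure)
open Literature.NumberTheory.GaloisCohomology
open Literature.NumberTheory.EllipticCurves.IwasawaDual
open Literature.NumberTheory.EllipticCurves.IwasawaAlgebra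
open Summit.BirchSwinnertonDyer.Rank1Residual
open Summit.BirchSwinnertonDyer.Rank1Residual.X5.SelfDualCount
open Summit.BirchSwinnertonDyer.Rank1Residual.GaloisImage.CoreRankZero (selmerGroup_mono)
open Summit.BirchSwinnertonDyer.Rank1Residual.Additive.PoitouTateCountingProduct
open Summit.BirchSwinnertonDyer.Rank1Residual.X11b.Levels
open Summit.BirchSwinnertonDyer.Rank1Residual.X11b
open Summit.BirchSwinnertonDyer.Rank1Residual.Additive
open Summit.BirchSwinnertonDyer.Rank1Residual.Additive.LevelBridge
open Summit.BirchSwinnertonDyer.Rank1Residual.Additive.RankZeroCount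
open scoped ContRepresentation

namespace Summit.BirchSwinnertonDyer.BirchSwinnertonDyer.Theorems


/-! ## §5 `p^v ∣ #(X_η/TX_η)_tors` for EVERY `v ≤ ∑_T ord_p c_ℓ(W)` under `hdivT` -/

section Pair

variable {V : WeierstrassCurve ℚ} [V.IsElliptic] [V.IsGloballyMinimal] {p : ℕ} [hp : Fact p.Prime]

/-- **`p^v ∣ #(X_η/TX_η)_tors` whenever `v ≤ ∑_{ℓ ∈ T} ord_p c_ℓ(W)` — NO rank term** at a tower-onto pair
(any rank `r = rank V^{(p*)}(ℚ)`), GRANTED Kobayashi's Thm. 1.2 / 1.3 / 2.2(η) / 4.1(η), `hPT` (NAMED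
facts), `p ≥ 5`, tower onto, the `V`-certificate, `coeff_r L_p⁺(V,η,T) ≠ 0`, the `p*`-partner `W` with
`T ∌ (p)` ⊇ every `ℓ ≠ p` with `p ∣ c_ℓ(W)`, `ord_p c_ℓ(W) ≤ m` on `T` (`m ≥ 1`) and the `T`-LOCAL
DIVISIBILITY `hdivT` of the rational points of `W` at level `p^m`. Chain (all kernel theorems): §4
`p^Σ · #κ_{p^m}(W(ℚ)) ∣ #Sel^{loc,∞,+}(W/ℚ)[p^m]` `= #Sel⁺(W/ℚ_∞)^Γ[p^m]` (part 2 §4, `h₀`)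
`≤ p^{m·rank_{ℤ_p}(X_η/T)} · #(X_η/T)_tors` (`…TamagawaRoadLevel` §1) with `rank_{ℤ_p}(X_η/T) = r`
(g3's `T`-semisimplicity), `#κ_{p^m}(W(ℚ)) ≥ p^{m·rank W(ℚ)}` (§3) and `rank W(ℚ) = r`
(`mordellWeilRank_quadraticTwist_eq_of_smul_quadraticTwist_eq`): `Σ + m·r ≤ m·r + j`.
[cite: Kobayashi2003, Thm. 2.2 (p. 5), Thm. 4.1 (p. 8), Thm. 9.3 (pp. 26–27)]
[cite: MilneADT2006, Ch. I, Thm. 4.10] [cite: GreenbergLNM1716, §3 Lemma 3.1–3.3, §4 Thm. 4.1]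
[cite: Howard2004HeegnerKolyvagin, Thm. 2.1.11] [cite: SilvermanAEC2009, VIII.§1–2, X.§4 (**)] -/
theorem pow_dvd_natCard_torsion_coinvariants_of_namedFacts_of_poitouTate_of_tamagawa_of_mordellWeilDivisible
    (h12 : Kobayashi2003.thm12_signedSelmerDual_finite_torsion)
    (h13 : Kobayashi2003.thm41_signedCharIdeal_divisibility)
    (h22 : Kobayashi2003.thm22_etaSignedSelmerDual_finite_torsion)
    (h41 : Kobayashi2003.thm41_plusEtaCharIdeal_dvd)
    (hPT : poitouTate_selmerStructure_duality_real ℚ)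
    (hp5 : 5 ≤ p) (hgood : V.HasGoodReductionAtPrime p) (hap : V.frobeniusTrace p = 0)
    (hsurj : ∀ m : ℕ, V.HasSurjectiveModNGaloisRep (p ^ m : ℕ))
    (hcertV : ∀ {N : ℕ} [NeZero N] (f : CuspForm (Gamma0 N) 2), IsNewformOf V f →
      ∃ L : IwasawaAlgebra p, Kobayashi2003.IsSignedPAdicLFunction f p 1 L ∧
        IsUnit (PowerSeries.coeff V.mordellWeilRank L))
    {N : ℕ} [NeZero N] {f : CuspForm (Gamma0 N) 2} (hf : IsNewformOf V f) (ϖ : ℚ)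
    (hϖ : if Even (p / 2) then (ϖ : ℝ) * V.realPeriodRat = plusPeriod f
      else (ϖ : ℝ) * V.imaginaryPeriodRat = minusPeriod f)
    (Lη : IwasawaAlgebra p) (hL : IsQuadraticBranchPlusLFunction f p ϖ Lη)
    (hne : PowerSeries.coeff (V.quadraticTwist ((-1) ^ (p / 2) * p)).mordellWeilRank Lη ≠ 0)
    (W : WeierstrassCurve ℚ) [W.IsElliptic] [W.IsGloballyMinimal] (C : VariableChange ℚ)
    (hCV : C • W.quadraticTwist ((-1) ^ (p / 2) * p) = V)
    (T : Finset (HeightOneSpectrum (𝓞 ℚ)))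
    (hpT : (Rat.HeightOneSpectrum.primesEquiv (R := 𝓞 ℚ)).symm ⟨p, hp.out⟩ ∉ T)
    (hT : ∀ v : HeightOneSpectrum (𝓞 ℚ), v ≠ (Rat.HeightOneSpectrum.primesEquiv (R := 𝓞 ℚ)).symm ⟨p, hp.out⟩ →
      p ∣ (W.baseChange (v.adicCompletion ℚ)).localTamagawaNumber (v.adicCompletionIntegers ℚ) → v ∈ T)
    (m : ℕ) (hm : 1 ≤ m)
    (hTm : ∀ w ∈ T, padicValNat p ((W.baseChange (w.adicCompletion ℚ)).localTamagawaNumber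
      (w.adicCompletionIntegers ℚ)) ≤ m)
    (hdiv : ∀ P : geomPoints W, ∃ Q : geomPoints W, ((p ^ m : ℕ) : ℤ) • Q = P)
    (hdivT : ∀ w ∈ T, ∀ P : W.toAffine.Point,
      galoisCohomology.localization (W.torsionGaloisModule ((p ^ m : ℕ) : ℤ)) (Sum.inr w) 1
        (kummerMapTorsion W ((p ^ m : ℕ) : ℤ) hdiv P) = 0)
    (K₀ : Type) [Field K₀] [NumberField K₀] [IsCyclotomicExtension {p} ℚ K₀]
    [(galRange (K := ℚ) K₀).Normal] (ηq : absoluteGaloisGroup ℚ →* ℤˣ)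
    (hηK : ∀ σ ∈ galRange (K := ℚ) K₀, ηq σ = 1) (hη1 : ηq ≠ 1)
    (κ : ZpExtension ℚ p) (γ : absoluteGaloisGroup ℚ) (hκ : κ.IsCyclotomic) (hγ : κ.IsTopGenerator γ)
    (hγK : γ ∈ galRange (K := ℚ) K₀) (hγc : IsCyclotomicVariable p γ)
    (D : EtaSignedSelmerDualData V κ K₀ ℚ_[p] ηq γ 1) (v : ℕ)
    (hv : v ≤ ∑ w ∈ T, padicValNat p ((W.baseChange (w.adicCompletion ℚ)).localTamagawaNumber
        (w.adicCompletionIntegers ℚ))) :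
    p ^ v ∣ Nat.card (AddCommGroup.torsion (IwasawaAlgebra.coinvariants p D.X)) := by
  have hp2 : p ≠ 2 := by omega
  have hpStar : ((-1 : ℚ) ^ (p / 2) * p) ≠ 0 :=
    mul_ne_zero (pow_ne_zero _ (by norm_num)) (Nat.cast_ne_zero.mpr hp.out.ne_zero)
  -- (1) `rank_{ℤ_p} X_η/TX_η = r` (g3's `T`-semisimplicity)
  obtain ⟨hfin, htor⟩ :=
    EtaSignedSelmerDualData.finite_isTorsion_of_thm22 h22 hηK hp2 hgood hap hκ hγ hγK D
  haveI : Module.Finite (IwasawaAlgebra p) D.X := hfin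
  obtain ⟨g, hg⟩ := (charIdeal_isPrincipal_holds p D.X).principal
  have hg' : D.charIdeal = Ideal.span {g} := hg
  obtain ⟨hord, hkfin⟩ :=
    order_eq_twistRank_and_finite_ker_bockstein_of_namedFacts_of_certV_of_coeff_ne_zero h12 h13 h22
      h41 hp5 hgood hap hsurj (fun f hf => hcertV f hf) hf ϖ hϖ Lη hL hne K₀ ηq hηK hη1 κ γ hκ hγ hγK
      hγc D hg'
  have hrank : coinvariantsRank p D.X = (V.quadraticTwist ((-1) ^ (p / 2) * p)).mordellWeilRank := by
    have h := (IwasawaAlgebra.order_charGenerator_eq_coinvariantsRank_iff_finite_ker_bockstein p D.X htor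
      g hg').mpr hkfin
    rw [hord] at h
    exact (ENat.coe_inj.mp h).symm
  -- (2) `D.X` is Pontryagin dual to `Sel⁺(W/ℚ_∞)` in `W`-coordinates; `X/TX ≅ Hom(Sel⁺_∞^Γ, ℚ/ℤ)`
  obtain ⟨toDualW, hdualW⟩ :=
    TamagawaRoad.exists_isDualPair_strictSigned_of_eta W C hp2 hCV hηK hη1 hκ hγ hγK D
  obtain ⟨Ψ, -⟩ := hdualW.exists_coinvariants_addEquiv
  -- (3) Pontryagin bookkeeping over `ℤ_p` at level `p^m`
  letI : Module ℤ_[p] (coinvariants p D.X) :=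
    Module.compHom _ (algebraMap ℤ_[p] (IwasawaAlgebra p))
  haveI : Module.Finite ℤ_[p] (coinvariants p D.X) := finite_int_coinvariants p D.X
  have hfr : Module.finrank ℤ_[p] (coinvariants p D.X) =
      (V.quadraticTwist ((-1) ^ (p / 2) * p)).mordellWeilRank :=
    (coinvariantsRank_eq_finrank_int D.X).symm.trans hrank
  obtain ⟨hfinS, hle⟩ :=
    TamagawaRoad.natCard_torsionBy_pow_le_pow_finrank_mul_natCard_torsion p m (coinvariants p D.X) Ψ
  obtain ⟨-, j, hj⟩ := TamagawaRoad.exists_natCard_torsion_eq_pow p (N := coinvariants p D.X)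
  rw [hfr, hj, ← pow_add] at hle
  -- (4) the `W`-side count WITH the Mordell–Weil classes, read on `Sel⁺(W/ℚ_∞)^Γ[p^m]`
  have hcount :=
    TamagawaRoad.prod_pow_padicValNat_localTamagawaNumber_mul_natCard_kummer_dvd_natCard_localPreimage_inf_torsionBy
      W p κ m hm hp2 hκ C V hCV hgood hap hPT T hpT hT hTm hdiv hdivT
  rw [TamagawaRoad.natCard_localPreimage_inf_torsionBy_eq κ W hp2 C V hCV hgood hap hγ m,
    Finset.prod_pow_eq_pow_sum] at hcount
  -- (5) `#κ_{p^m}(W(ℚ)) ≥ p^{m·rank W(ℚ)}` and `rank W(ℚ) = r`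
  obtain ⟨-, hB⟩ := TamagawaRoad.pow_mul_mordellWeilRank_le_natCard_setRange_kummerMapTorsion W p m hdiv
  have hrW : W.mordellWeilRank = (V.quadraticTwist ((-1) ^ (p / 2) * p)).mordellWeilRank :=
    (TamagawaRoad.mordellWeilRank_quadraticTwist_eq_of_smul_quadraticTwist_eq hpStar hCV).symm
  rw [hrW] at hB
  -- assemble: `p^Σ · p^{m r} ≤ p^Σ · #B ≤ #S[p^m] ≤ p^(m r + j)`
  haveI := hfinS
  have hpos : 0 < Nat.card
      ↥((↥(endInvariants (conjStrictSignedSelmerInfty W κ ℚ_[p] 1 γ - 1)))[((p ^ m : ℕ) : ℤ)]) :=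
    Nat.card_pos
  have h1 := (Nat.le_of_dvd hpos hcount).trans hle
  have h2 : p ^ (∑ w ∈ T, padicValNat p ((W.baseChange (w.adicCompletion ℚ)).localTamagawaNumber
        (w.adicCompletionIntegers ℚ))) * p ^ (m * (V.quadraticTwist ((-1) ^ (p / 2) * p)).mordellWeilRank) ≤
      p ^ (m * (V.quadraticTwist ((-1) ^ (p / 2) * p)).mordellWeilRank + j) :=
    (Nat.mul_le_mul_left _ hB).trans h1
  rw [← pow_add] at h2
  have h3 := (Nat.pow_le_pow_iff_right hp.out.one_lt).mp h2
  rw [hj]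
  exact pow_dvd_pow p (by omega)

/-! ## §6 (E⁺_η) at the pair — the Tamagawa road with the Mordell–Weil classes -/

/-- **THE TAMAGAWA ROAD WITH THE MORDELL–WEIL CLASSES: (E⁺_η) AT A TOWER-ONTO PAIR OF ANY RANK** from
the named facts (Kobayashi 1.2/1.3/2.2η/4.1η, Kitajima–Otsuki 1.3η, Poitou–Tate), `p ≥ 5`, tower onto,
the `V`-certificate, the `p*`-partner `W` with `T ∌ (p)` ⊇ every `ℓ ≠ p` with `p ∣ c_ℓ(W)`,
`ord_p c_ℓ(W) ≤ m` on `T` (`m ≥ 1`), the `T`-local divisibility `hdivT` of `W(ℚ)` at level `p^m`, the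
ANALYTIC certificate `p^{v+1} ∤ coeff_r L_p⁺(V,η,T)` and the ARITHMETIC input **`v ≤ ∑_{ℓ ∈ T} ord_p
c_ℓ(W)`** (no rank term). As `…_of_tamagawa_level` (p515783) with §5 in place of its §2. CONDITIONAL;
closes nothing class-wide; certifies no row. [cite: Kobayashi2003, Thm. 2.2 (p. 5), Thm. 4.1 and §4 (p. 8)]
[cite: KitajimaOtsuki2018, Thm. 1.3] [cite: MilneADT2006, Ch. I, Thm. 4.10] [cite: CoatesSchneiderSujatha2003, §3 (30)–(31)] -/
theorem quadraticBranchPlusEtaLowerInclusionAt_of_namedFacts_of_certV_of_poitouTate_of_tamagawa_of_mordellWeilDivisible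
    (h12 : Kobayashi2003.thm12_signedSelmerDual_finite_torsion)
    (h13 : Kobayashi2003.thm41_signedCharIdeal_divisibility)
    (h22 : Kobayashi2003.thm22_etaSignedSelmerDual_finite_torsion)
    (h41 : Kobayashi2003.thm41_plusEtaCharIdeal_dvd)
    (hKO : KitajimaOtsuki2018.mainThm13_etaSignedSelmerDual_noFiniteSubmodule)
    (hPT : poitouTate_selmerStructure_duality_real ℚ)
    (hp5 : 5 ≤ p) (hgood : V.HasGoodReductionAtPrime p) (hap : V.frobeniusTrace p = 0)
    (hsurj : ∀ m : ℕ, V.HasSurjectiveModNGaloisRep (p ^ m : ℕ))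
    (hcertV : ∀ {N : ℕ} [NeZero N] (f : CuspForm (Gamma0 N) 2), IsNewformOf V f →
      ∃ L : IwasawaAlgebra p, Kobayashi2003.IsSignedPAdicLFunction f p 1 L ∧
        IsUnit (PowerSeries.coeff V.mordellWeilRank L))
    (W : WeierstrassCurve ℚ) [W.IsElliptic] [W.IsGloballyMinimal] (C : VariableChange ℚ)
    (hCV : C • W.quadraticTwist ((-1) ^ (p / 2) * p) = V)
    (T : Finset (HeightOneSpectrum (𝓞 ℚ)))
    (hpT : (Rat.HeightOneSpectrum.primesEquiv (R := 𝓞 ℚ)).symm ⟨p, hp.out⟩ ∉ T)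
    (hT : ∀ v : HeightOneSpectrum (𝓞 ℚ), v ≠ (Rat.HeightOneSpectrum.primesEquiv (R := 𝓞 ℚ)).symm ⟨p, hp.out⟩ →
      p ∣ (W.baseChange (v.adicCompletion ℚ)).localTamagawaNumber (v.adicCompletionIntegers ℚ) → v ∈ T)
    (m : ℕ) (hm : 1 ≤ m)
    (hTm : ∀ w ∈ T, padicValNat p ((W.baseChange (w.adicCompletion ℚ)).localTamagawaNumber
      (w.adicCompletionIntegers ℚ)) ≤ m)
    (hdiv : ∀ P : geomPoints W, ∃ Q : geomPoints W, ((p ^ m : ℕ) : ℤ) • Q = P)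
    (hdivT : ∀ w ∈ T, ∀ P : W.toAffine.Point,
      galoisCohomology.localization (W.torsionGaloisModule ((p ^ m : ℕ) : ℤ)) (Sum.inr w) 1
        (kummerMapTorsion W ((p ^ m : ℕ) : ℤ) hdiv P) = 0)
    (v : ℕ)
    (hv : v ≤ ∑ w ∈ T, padicValNat p ((W.baseChange (w.adicCompletion ℚ)).localTamagawaNumber
        (w.adicCompletionIntegers ℚ)))
    (han : ∀ {N : ℕ} [NeZero N] {f : CuspForm (Gamma0 N) 2}, IsNewformOf V f →
      ∀ (ϖ : ℚ), (if Even (p / 2) then (ϖ : ℝ) * V.realPeriodRat = plusPeriod f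
          else (ϖ : ℝ) * V.imaginaryPeriodRat = minusPeriod f) →
      ∀ (Lη : IwasawaAlgebra p), IsQuadraticBranchPlusLFunction f p ϖ Lη →
        ¬ (p : ℤ_[p]) ^ (v + 1) ∣
          PowerSeries.coeff (V.quadraticTwist ((-1) ^ (p / 2) * p)).mordellWeilRank Lη) :
    QuadraticBranchPlusEtaLowerInclusionAt V p := by
  intro K₀ _ _ _ _ ηq hηK hη1 N _ f hp2 hgood' hap' hf ϖ hϖ Lη hL κ γ hκ hγ hγK hγc D
  obtain ⟨hfin, htor⟩ :=
    EtaSignedSelmerDualData.finite_isTorsion_of_thm22 h22 hηK hp2 hgood' hap' hκ hγ hγK D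
  haveI : Module.Finite (IwasawaAlgebra p) D.X := hfin
  obtain ⟨g, hg⟩ := (charIdeal_isPrincipal_holds p D.X).principal
  have hg' : D.charIdeal = Ideal.span {g} := hg
  obtain ⟨-, hup⟩ := EtaSignedSelmerDualData.thm41_plus_of_facts h22 h41 hηK hη1 hp2 hgood' hap' hf
    ϖ hϖ Lη hL hκ hγ hγK hγc D
  have hgL : g ∣ Lη := by
    have h := hup hsurj
    rw [hg', Ideal.span_singleton_le_span_singleton] at h
    exact h
  have hanL := han hf ϖ hϖ Lη hL
  have hne : PowerSeries.coeff (V.quadraticTwist ((-1) ^ (p / 2) * p)).mordellWeilRank Lη ≠ 0 :=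
    fun h0 => hanL (by rw [h0]; exact dvd_zero _)
  have hXg := X_pow_twistRank_dvd_etaCharGenerator_of_namedFacts_of_certV h12 h13 h22 hp5 hgood hap
    hsurj (fun f hf => hcertV f hf) hf K₀ ηq hηK hη1 κ γ hκ hγ hγK hγc D hg'
  obtain ⟨u, hu⟩ := coeff_twistRank_etaCharGenerator_eq_unit_mul_card_coker_bockstein h12 h13 h22 h41
    hKO hp5 hgood hap hsurj (fun f hf => hcertV f hf) hf ϖ hϖ Lη hL hne K₀ ηq hηK hη1 κ γ hκ hγ hγK hγc
    D hg'
  obtain ⟨-, hdvd⟩ := ker_bockstein_eq_bot_and_natCard_torsion_coinvariants_dvd h12 h13 h22 h41 hKO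
    hp5 hgood hap hsurj (fun f hf => hcertV f hf) hf ϖ hϖ Lη hL hne K₀ ηq hηK hη1 κ γ hκ hγ hγK hγc D
  have htors :=
    pow_dvd_natCard_torsion_coinvariants_of_namedFacts_of_poitouTate_of_tamagawa_of_mordellWeilDivisible
      h12 h13 h22 h41 hPT hp5 hgood hap hsurj (fun f hf => hcertV f hf) hf ϖ hϖ Lη hL hne W C hCV T hpT hT
      m hm hTm hdiv hdivT K₀ ηq hηK hη1 κ γ hκ hγ hγK hγc D v hv
  have halg : (p : ℤ_[p]) ^ v ∣
      PowerSeries.coeff (V.quadraticTwist ((-1) ^ (p / 2) * p)).mordellWeilRank g := by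
    rw [hu]
    obtain ⟨c, hc⟩ := htors.trans hdvd
    refine Dvd.dvd.mul_left ?_ _
    rw [hc, Nat.cast_mul, Nat.cast_pow]
    exact dvd_mul_right _ _
  have heq : Ideal.span {g} = Ideal.span {Lη} :=
    span_singleton_eq_of_X_pow_dvd_of_dvd_of_pow_dvd_coeff hXg hgL halg hanL
  rw [← heq, ← hg']

/-! ## §7 The even main conjecture at `η` in full at the pair -/

/-- **(E⁺_η) ∧ (C1⁺_η) — Kobayashi's even main conjecture at `η` IN FULL at a tower-onto pair, from the
Tamagawa road with the Mordell–Weil classes.** Same hypotheses as §6; the equality follows from the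
lower inclusion, Thm. 2.2 / 4.1 at `η` and surjectivity
(`quadraticBranchPlusEtaMainConjectureAt_of_facts_of_surjective_of_etaLowerInclusion`). CONDITIONAL;
closes nothing class-wide; certifies no row in the kernel.
[cite: Kobayashi2003, Thm. 2.2 (p. 5), §4 Even main conjecture and Thm. 4.1 (p. 8)]
[cite: KitajimaOtsuki2018, Thm. 1.3] [cite: MilneADT2006, Ch. I, Thm. 4.10] -/
theorem quadraticBranchPlusEta_lowerInclusion_and_mainConjectureAt_of_namedFacts_of_poitouTate_of_tamagawa_of_mordellWeilDivisible
    (h12 : Kobayashi2003.thm12_signedSelmerDual_finite_torsion)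
    (h13 : Kobayashi2003.thm41_signedCharIdeal_divisibility)
    (h22 : Kobayashi2003.thm22_etaSignedSelmerDual_finite_torsion)
    (h41 : Kobayashi2003.thm41_plusEtaCharIdeal_dvd)
    (hKO : KitajimaOtsuki2018.mainThm13_etaSignedSelmerDual_noFiniteSubmodule)
    (hPT : poitouTate_selmerStructure_duality_real ℚ)
    (hp5 : 5 ≤ p) (hgood : V.HasGoodReductionAtPrime p) (hap : V.frobeniusTrace p = 0)
    (hsurj : ∀ m : ℕ, V.HasSurjectiveModNGaloisRep (p ^ m : ℕ))
    (hcertV : ∀ {N : ℕ} [NeZero N] (f : CuspForm (Gamma0 N) 2), IsNewformOf V f →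
      ∃ L : IwasawaAlgebra p, Kobayashi2003.IsSignedPAdicLFunction f p 1 L ∧
        IsUnit (PowerSeries.coeff V.mordellWeilRank L))
    (W : WeierstrassCurve ℚ) [W.IsElliptic] [W.IsGloballyMinimal] (C : VariableChange ℚ)
    (hCV : C • W.quadraticTwist ((-1) ^ (p / 2) * p) = V)
    (T : Finset (HeightOneSpectrum (𝓞 ℚ)))
    (hpT : (Rat.HeightOneSpectrum.primesEquiv (R := 𝓞 ℚ)).symm ⟨p, hp.out⟩ ∉ T)
    (hT : ∀ v : HeightOneSpectrum (𝓞 ℚ), v ≠ (Rat.HeightOneSpectrum.primesEquiv (R := 𝓞 ℚ)).symm ⟨p, hp.out⟩ →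
      p ∣ (W.baseChange (v.adicCompletion ℚ)).localTamagawaNumber (v.adicCompletionIntegers ℚ) → v ∈ T)
    (m : ℕ) (hm : 1 ≤ m)
    (hTm : ∀ w ∈ T, padicValNat p ((W.baseChange (w.adicCompletion ℚ)).localTamagawaNumber
      (w.adicCompletionIntegers ℚ)) ≤ m)
    (hdiv : ∀ P : geomPoints W, ∃ Q : geomPoints W, ((p ^ m : ℕ) : ℤ) • Q = P)
    (hdivT : ∀ w ∈ T, ∀ P : W.toAffine.Point,
      galoisCohomology.localization (W.torsionGaloisModule ((p ^ m : ℕ) : ℤ)) (Sum.inr w) 1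
        (kummerMapTorsion W ((p ^ m : ℕ) : ℤ) hdiv P) = 0)
    (v : ℕ)
    (hv : v ≤ ∑ w ∈ T, padicValNat p ((W.baseChange (w.adicCompletion ℚ)).localTamagawaNumber
        (w.adicCompletionIntegers ℚ)))
    (han : ∀ {N : ℕ} [NeZero N] {f : CuspForm (Gamma0 N) 2}, IsNewformOf V f →
      ∀ (ϖ : ℚ), (if Even (p / 2) then (ϖ : ℝ) * V.realPeriodRat = plusPeriod f
          else (ϖ : ℝ) * V.imaginaryPeriodRat = minusPeriod f) →
      ∀ (Lη : IwasawaAlgebra p), IsQuadraticBranchPlusLFunction f p ϖ Lη →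
        ¬ (p : ℤ_[p]) ^ (v + 1) ∣
          PowerSeries.coeff (V.quadraticTwist ((-1) ^ (p / 2) * p)).mordellWeilRank Lη) :
    QuadraticBranchPlusEtaLowerInclusionAt V p ∧ QuadraticBranchPlusEtaMainConjectureAt V p := by
  have hE :=
    quadraticBranchPlusEtaLowerInclusionAt_of_namedFacts_of_certV_of_poitouTate_of_tamagawa_of_mordellWeilDivisible
      h12 h13 h22 h41 hKO hPT hp5 hgood hap hsurj (fun f hf => hcertV f hf) W C hCV T hpT hT m hm hTm hdiv hdivT v hv
      (fun hf => han hf)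
  exact ⟨hE, quadraticBranchPlusEtaMainConjectureAt_of_facts_of_surjective_of_etaLowerInclusion h22 h41
    hsurj hE⟩

end Pair

end Summit.BirchSwinnertonDyer.BirchSwinnertonDyer.Theorems

end
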